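import Summits.Ventures.YMGap.RobustBall.BoundaryDecayBall
import Summits.Ventures.YMGap.RobustBall.PeriodisedBox
import HarnessLib

/-!
# Venture YMGap, track ROBUST-BALL — ONE STATE AT A RATE in EVERY DIMENSION: the `SU(2)` Wilson point on `ℤ^d` (in particular `ℤ³`)

HONEST FRAMING. WHAT THIS IS: a venture file (cell `pub-ymgap`, track Y2 ROBUST-BALL, seat ds-3, theorems only): the every-`d` reading of
the `SU(2)` boundary-rate theorem `su2_abs_boundary_sub_integral_le` (`BoundaryDecayBall.lean`, sharp one-link pair, hypothesis-free) at the
WILSON POINT (zero member). Row sum `2(d−1)|β_W|` (Wilson `β_W`, tree coupling `β_W/2`, 't Hooft `β_W/4`):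
* ★ `su2_wilson_boundary_dim_upTo` — every `d ≥ 1`, `0 ≤ β_W` with `2(d−1) β_W ≤ 1/2`: for EVERY DLR state `μ`, every finite volume `Λ`,
  EVERY boundary field `η`, every Lipschitz cylinder `F` (constant `K`, links `Δ` at depth `≥ D` in `Λ`):
  `|∫ F dγ_Λ(· | η) − ∫ F dμ| ≤ 2√2 · K · #Δ · (1/2)^{⌊D⌋}`;
* ★ `su2_wilson_boundary_dim_lt` — every `d ≥ 2`, `1/2 ≤ 2(d−1) β_W < 1`: the same with ratio `(2(d−1) β_W)^{⌊D⌋}`;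
* `su2_wilson_box_dim_upTo` / `_lt` — boxes (`Δ ⊆ boxLinks d m`, `Λ = boxLinks d n`): exponents `n − m`;
* ★ `ℤ³`: `su2_wilson_boundary_dim3_upTo_oneEighth` (`0 ≤ β_W ≤ 1/8`: `(1/2)^{⌊D⌋}`), `su2_wilson_boundary_dim3_lt_oneQuarter`
  (`1/8 ≤ β_W < 1/4`: `(4β_W)^{⌊D⌋}`) — THREE-DIMENSIONAL `SU(2)` lattice Yang–Mills forgets its boundary exponentially fast for `β_W < 1/4`.
WHAT THIS IS NOT: Dobrushin-comparison lower bound on the rate inside the single-link door (`2(d−1)β_W < 1`); lattice strong coupling;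
nothing about the continuum limit or the Clay Millennium problem.

References: H. Föllmer, LNM 1362 (1988), Ch. I, (2.8)/(2.10); the seat's `BoundaryDecayBall.lean`.
-/

noncomputable section

open MeasureTheory Filter Function ProbabilityTheory Real
open scoped NNReal
open Literature.Probability.LatticeModels
open Literature.MathematicalPhysics.QuantumLattice
open Literature.MathematicalPhysics.QuantumFieldTheory hiding ZdEdge

namespace Summit.Ventures.YMGap.RobustBall

variable {d : ℕ}

/-- ★ **`SU(2)` WILSON ON `ℤ^d`, every `d ≥ 1`, `0 ≤ β_W`, `2(d−1)β_W ≤ 1/2`**: every DLR state `μ` (tree coupling `β_W/2`) and every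
finite-volume Wilson distribution with ANY boundary field satisfy, on Lipschitz cylinders at depth `D`,
`|∫ F dγ_Λ(· | η) − ∫ F dμ| ≤ 2√2 · K · #Δ · (1/2)^{⌊D⌋}`. [folklore] -/
theorem su2_wilson_boundary_dim_upTo (hd : 1 ≤ d) {βW : ℝ} (h0 : 0 ≤ βW) (h : 2 * ((d : ℝ) - 1) * βW ≤ 1 / 2)
    {μ : Measure (LGConfig d (Matrix.specialUnitaryGroup (Fin 2) ℂ))}
    (hμ : μ ∈ ymGibbsMeasures (d := d) (fundamentalRep (Fin 2)) (βW / 2))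
    (Λ : Finset (ZdEdge d)) (η : LGConfig d (Matrix.specialUnitaryGroup (Fin 2) ℂ))
    {F : LGConfig d (Matrix.specialUnitaryGroup (Fin 2) ℂ) → ℝ} {Δ : Finset (ZdEdge d)} {K : ℝ≥0}
    (hF : IsLipschitzCylinder (fundamentalRep (Fin 2)) F Δ K) {D : ℝ}
    (hD : ∀ y ∈ Δ, ∀ z, z ∉ Λ → D ≤ ‖y.1 - z.1‖) :
    |(∫ U, F U ∂(ymSpecification (d := d) (fundamentalRep (Fin 2)) (βW / 2) Λ η)) - ∫ U, F U ∂μ| ≤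
      2 * Real.sqrt 2 * K * Δ.card * (1 / 2 : ℝ) ^ ⌊D⌋₊ := by
  have hβ : (((2 : ℕ) : ℝ) * (βW / 4) : ℝ) = βW / 2 := by push_cast; ring
  have hmem : MemBallZd (N := 2) (0 : ℝ) 0 0 (0 : Potential (ZdEdge d) (Matrix.specialUnitaryGroup (Fin 2) ℂ))
      (fun _ => (∅ : Finset (Finset (ZdEdge d)))) :=
    memBallZd_zero le_rfl le_rfl fun _ _ h => by simp at h
  have hμ' : μ ∈ perturbedGibbsMeasures (d := d) (fundamentalRep (Fin 2)) ((2 : ℕ) * (βW / 4)) 0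
      (fun _ => (∅ : Finset (Finset (ZdEdge d)))) := by
    rwa [perturbedGibbsMeasures_zero, hβ]
  have key := su2_abs_boundary_sub_integral_le hd (ρ := 1 / 2) (ε₀ := 0) (ε₁ := 0) (R := 0) (βW := βW) (by
      rw [abs_of_nonneg h0, Real.exp_zero, zero_div, Real.exp_zero, mul_one, mul_zero, add_zero]
      exact h) (by norm_num) hmem hμ' Λ η hF hD
  rw [perturbedYM_zero, hβ, max_self, max_eq_left (zero_le_one : (0 : ℝ) ≤ 1), div_one] at key
  exact key

/-- ★ **`SU(2)` WILSON ON `ℤ^d`, `1/2 ≤ 2(d−1)β_W < 1`**: the same with the geometric ratio `2(d−1)β_W`: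
`|∫ F dγ_Λ(· | η) − ∫ F dμ| ≤ 2√2 · K · #Δ · (2(d−1)β_W)^{⌊D⌋}`. [folklore] -/
theorem su2_wilson_boundary_dim_lt (hd : 1 ≤ d) {βW : ℝ} (h0 : 1 / 2 ≤ 2 * ((d : ℝ) - 1) * βW) (h : 2 * ((d : ℝ) - 1) * βW < 1)
    {μ : Measure (LGConfig d (Matrix.specialUnitaryGroup (Fin 2) ℂ))}
    (hμ : μ ∈ ymGibbsMeasures (d := d) (fundamentalRep (Fin 2)) (βW / 2))
    (Λ : Finset (ZdEdge d)) (η : LGConfig d (Matrix.specialUnitaryGroup (Fin 2) ℂ))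
    {F : LGConfig d (Matrix.specialUnitaryGroup (Fin 2) ℂ) → ℝ} {Δ : Finset (ZdEdge d)} {K : ℝ≥0}
    (hF : IsLipschitzCylinder (fundamentalRep (Fin 2)) F Δ K) {D : ℝ}
    (hD : ∀ y ∈ Δ, ∀ z, z ∉ Λ → D ≤ ‖y.1 - z.1‖) :
    |(∫ U, F U ∂(ymSpecification (d := d) (fundamentalRep (Fin 2)) (βW / 2) Λ η)) - ∫ U, F U ∂μ| ≤
      2 * Real.sqrt 2 * K * Δ.card * (2 * ((d : ℝ) - 1) * βW) ^ ⌊D⌋₊ := by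
  have hd1 : (0 : ℝ) ≤ (d : ℝ) - 1 := by
    have : (1 : ℝ) ≤ d := by exact_mod_cast hd
    linarith
  have hβ0 : 0 ≤ βW := by
    by_contra hneg
    have hlt : βW < 0 := lt_of_not_ge hneg
    have : 2 * ((d : ℝ) - 1) * βW ≤ 0 := mul_nonpos_of_nonneg_of_nonpos (by positivity) hlt.le
    linarith
  have hβ : (((2 : ℕ) : ℝ) * (βW / 4) : ℝ) = βW / 2 := by push_cast; ring
  have hmem : MemBallZd (N := 2) (0 : ℝ) 0 0 (0 : Potential (ZdEdge d) (Matrix.specialUnitaryGroup (Fin 2) ℂ))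
      (fun _ => (∅ : Finset (Finset (ZdEdge d)))) :=
    memBallZd_zero le_rfl le_rfl fun _ _ h => by simp at h
  have hμ' : μ ∈ perturbedGibbsMeasures (d := d) (fundamentalRep (Fin 2)) ((2 : ℕ) * (βW / 4)) 0
      (fun _ => (∅ : Finset (Finset (ZdEdge d)))) := by
    rwa [perturbedGibbsMeasures_zero, hβ]
  have key := su2_abs_boundary_sub_integral_le hd (ρ := 2 * ((d : ℝ) - 1) * βW) (ε₀ := 0) (ε₁ := 0) (R := 0) (βW := βW) (by
      rw [abs_of_nonneg hβ0, Real.exp_zero, zero_div, Real.exp_zero, mul_one, mul_zero, add_zero]) h hmem hμ' Λ η hF hD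
  rw [perturbedYM_zero, hβ, max_eq_left h0, max_eq_left (zero_le_one : (0 : ℝ) ≤ 1), div_one] at key
  exact key

/-- Free room between nested boxes (`BoundaryDecayBox.sub_le_norm_sub_of_mem_boxLinks`, restated to keep this file's imports built). [folklore] -/
private theorem natCast_sub_le_norm_sub {m n : ℕ} {y z : ZdEdge d} (hy : y ∈ boxLinks d m) (hz : z ∉ boxLinks d n) :
    (n : ℝ) - m ≤ ‖y.1 - z.1‖ := by
  rw [mem_boxLinks, mem_siteBox_iff_norm] at hy hz
  have hz' : (n : ℝ) < ‖z.1‖ := lt_of_not_ge hz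
  have h := norm_sub_norm_le z.1 y.1
  rw [norm_sub_rev] at h
  linarith

/-- `⌊(n : ℝ) − m⌋₊ = n − m` (truncated subtraction; `BoundaryDecayBox.natFloor_natCast_sub_natCast` restated). [folklore] -/
private theorem natFloor_sub (n m : ℕ) : ⌊(n : ℝ) - m⌋₊ = n - m := by
  rcases le_or_gt m n with h | h
  · rw [← Nat.cast_sub h, Nat.floor_natCast]
  · rw [Nat.floor_of_nonpos (by linarith [(Nat.cast_lt (α := ℝ)).2 h]), eq_comm]
    omega

/-- **Boxes, every `d ≥ 1`, `2(d−1)β_W ≤ 1/2`**: `|∫ F dγ_{boxLinks d n}(· | η) − ∫ F dμ| ≤ 2√2 · K · #Δ · (1/2)^{n − m}` for Lipschitz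
cylinders based in `[−m, m]^d`. [folklore] -/
theorem su2_wilson_box_dim_upTo (hd : 1 ≤ d) {βW : ℝ} (h0 : 0 ≤ βW) (h : 2 * ((d : ℝ) - 1) * βW ≤ 1 / 2)
    {μ : Measure (LGConfig d (Matrix.specialUnitaryGroup (Fin 2) ℂ))}
    (hμ : μ ∈ ymGibbsMeasures (d := d) (fundamentalRep (Fin 2)) (βW / 2)) {m : ℕ} (n : ℕ)
    (η : LGConfig d (Matrix.specialUnitaryGroup (Fin 2) ℂ))
    {F : LGConfig d (Matrix.specialUnitaryGroup (Fin 2) ℂ) → ℝ} {Δ : Finset (ZdEdge d)} {K : ℝ≥0}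
    (hF : IsLipschitzCylinder (fundamentalRep (Fin 2)) F Δ K) (hΔ : Δ ⊆ boxLinks d m) :
    |(∫ U, F U ∂(ymSpecification (d := d) (fundamentalRep (Fin 2)) (βW / 2) (boxLinks d n) η)) - ∫ U, F U ∂μ| ≤
      2 * Real.sqrt 2 * K * Δ.card * (1 / 2 : ℝ) ^ (n - m) := by
  have key := su2_wilson_boundary_dim_upTo hd h0 h hμ (boxLinks d n) η hF (D := (n : ℝ) - m)
    fun _ hy _ hz => natCast_sub_le_norm_sub (hΔ hy) hz
  rwa [natFloor_sub] at key

/-- **Boxes, `1/2 ≤ 2(d−1)β_W < 1`**: ratio `(2(d−1)β_W)^{n − m}`. [folklore] -/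
theorem su2_wilson_box_dim_lt (hd : 1 ≤ d) {βW : ℝ} (h0 : 1 / 2 ≤ 2 * ((d : ℝ) - 1) * βW) (h : 2 * ((d : ℝ) - 1) * βW < 1)
    {μ : Measure (LGConfig d (Matrix.specialUnitaryGroup (Fin 2) ℂ))}
    (hμ : μ ∈ ymGibbsMeasures (d := d) (fundamentalRep (Fin 2)) (βW / 2)) {m : ℕ} (n : ℕ)
    (η : LGConfig d (Matrix.specialUnitaryGroup (Fin 2) ℂ))
    {F : LGConfig d (Matrix.specialUnitaryGroup (Fin 2) ℂ) → ℝ} {Δ : Finset (ZdEdge d)} {K : ℝ≥0}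
    (hF : IsLipschitzCylinder (fundamentalRep (Fin 2)) F Δ K) (hΔ : Δ ⊆ boxLinks d m) :
    |(∫ U, F U ∂(ymSpecification (d := d) (fundamentalRep (Fin 2)) (βW / 2) (boxLinks d n) η)) - ∫ U, F U ∂μ| ≤
      2 * Real.sqrt 2 * K * Δ.card * (2 * ((d : ℝ) - 1) * βW) ^ (n - m) := by
  have key := su2_wilson_boundary_dim_lt hd h0 h hμ (boxLinks d n) η hF (D := (n : ℝ) - m)
    fun _ hy _ hz => natCast_sub_le_norm_sub (hΔ hy) hz
  rwa [natFloor_sub] at key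

/-! ### `ℤ³` -/

/-- ★ **THREE-DIMENSIONAL `SU(2)` LATTICE YANG–MILLS, `0 ≤ β_W ≤ 1/8`** (tree coupling `β_W/2`): every DLR state and every finite-volume
Wilson distribution with ANY boundary field satisfy `|∫ F dγ_Λ(· | η) − ∫ F dμ| ≤ 2√2 · K · #Δ · (1/2)^{⌊D⌋}` on Lipschitz cylinders at
depth `D`. [folklore] -/
theorem su2_wilson_boundary_dim3_upTo_oneEighth {βW : ℝ} (h0 : 0 ≤ βW) (h : βW ≤ 1 / 8)
    {μ : Measure (LGConfig 3 (Matrix.specialUnitaryGroup (Fin 2) ℂ))}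
    (hμ : μ ∈ ymGibbsMeasures (d := 3) (fundamentalRep (Fin 2)) (βW / 2))
    (Λ : Finset (ZdEdge 3)) (η : LGConfig 3 (Matrix.specialUnitaryGroup (Fin 2) ℂ))
    {F : LGConfig 3 (Matrix.specialUnitaryGroup (Fin 2) ℂ) → ℝ} {Δ : Finset (ZdEdge 3)} {K : ℝ≥0}
    (hF : IsLipschitzCylinder (fundamentalRep (Fin 2)) F Δ K) {D : ℝ}
    (hD : ∀ y ∈ Δ, ∀ z, z ∉ Λ → D ≤ ‖y.1 - z.1‖) :
    |(∫ U, F U ∂(ymSpecification (d := 3) (fundamentalRep (Fin 2)) (βW / 2) Λ η)) - ∫ U, F U ∂μ| ≤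
      2 * Real.sqrt 2 * K * Δ.card * (1 / 2 : ℝ) ^ ⌊D⌋₊ :=
  su2_wilson_boundary_dim_upTo (d := 3) (by norm_num) h0 (by push_cast; linarith) hμ Λ η hF hD

/-- ★ **THREE-DIMENSIONAL `SU(2)`, `1/8 ≤ β_W < 1/4`**: ratio `(4β_W)^{⌊D⌋}`. [folklore] -/
theorem su2_wilson_boundary_dim3_lt_oneQuarter {βW : ℝ} (h0 : 1 / 8 ≤ βW) (h : βW < 1 / 4)
    {μ : Measure (LGConfig 3 (Matrix.specialUnitaryGroup (Fin 2) ℂ))}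
    (hμ : μ ∈ ymGibbsMeasures (d := 3) (fundamentalRep (Fin 2)) (βW / 2))
    (Λ : Finset (ZdEdge 3)) (η : LGConfig 3 (Matrix.specialUnitaryGroup (Fin 2) ℂ))
    {F : LGConfig 3 (Matrix.specialUnitaryGroup (Fin 2) ℂ) → ℝ} {Δ : Finset (ZdEdge 3)} {K : ℝ≥0}
    (hF : IsLipschitzCylinder (fundamentalRep (Fin 2)) F Δ K) {D : ℝ}
    (hD : ∀ y ∈ Δ, ∀ z, z ∉ Λ → D ≤ ‖y.1 - z.1‖) :
    |(∫ U, F U ∂(ymSpecification (d := 3) (fundamentalRep (Fin 2)) (βW / 2) Λ η)) - ∫ U, F U ∂μ| ≤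
      2 * Real.sqrt 2 * K * Δ.card * (4 * βW) ^ ⌊D⌋₊ := by
  have key := su2_wilson_boundary_dim_lt (d := 3) (by norm_num) (βW := βW) (by push_cast; linarith) (by push_cast; linarith)
    hμ Λ η hF hD
  have e : 2 * (((3 : ℕ) : ℝ) - 1) * βW = 4 * βW := by push_cast; ring
  rwa [e] at key

/-- **`ℤ³`, boxes, `0 ≤ β_W ≤ 1/8`**: `|∫ F dγ_{boxLinks 3 n}(· | η) − ∫ F dμ| ≤ 2√2 · K · #Δ · (1/2)^{n − m}`. [folklore] -/
theorem su2_wilson_box_dim3_upTo_oneEighth {βW : ℝ} (h0 : 0 ≤ βW) (h : βW ≤ 1 / 8)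
    {μ : Measure (LGConfig 3 (Matrix.specialUnitaryGroup (Fin 2) ℂ))}
    (hμ : μ ∈ ymGibbsMeasures (d := 3) (fundamentalRep (Fin 2)) (βW / 2)) {m : ℕ} (n : ℕ)
    (η : LGConfig 3 (Matrix.specialUnitaryGroup (Fin 2) ℂ))
    {F : LGConfig 3 (Matrix.specialUnitaryGroup (Fin 2) ℂ) → ℝ} {Δ : Finset (ZdEdge 3)} {K : ℝ≥0}
    (hF : IsLipschitzCylinder (fundamentalRep (Fin 2)) F Δ K) (hΔ : Δ ⊆ boxLinks 3 m) :
    |(∫ U, F U ∂(ymSpecification (d := 3) (fundamentalRep (Fin 2)) (βW / 2) (boxLinks 3 n) η)) - ∫ U, F U ∂μ| ≤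
      2 * Real.sqrt 2 * K * Δ.card * (1 / 2 : ℝ) ^ (n - m) :=
  su2_wilson_box_dim_upTo (d := 3) (by norm_num) h0 (by push_cast; linarith) hμ n η hF hΔ

end Summit.Ventures.YMGap.RobustBall

end
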